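import Literature.Probability.Moments.BennettBernstein
import Mathlib.Probability.Moments.Basic
import HarnessLib

/-!
# Cramér–Chernoff with a Bennett-type bound on the moment generating function

Topic `Literature/Probability/Moments`; the tail step of `BennettBernsteinMeasure.lean` (Bennett's and
Bernstein's inequalities for independent sums) isolated as a statement about ONE real random variable,
so that it can be reused for dependent statistics whose moment generating function obeys the same
bound (U-statistics: `UStatisticBernstein.lean`).  Boucheron–Lugosi–Massart, *Concentration
Inequalities* (OUP 2013), §2.7, proof of Theorem 2.9 and eq. (2.10) (held text pp. 35–36): from
`log E e^{λS} ≤ (v/b²) φ(bλ)` (`φ(u) = e^u − u − 1`) the Cramér–Chernoff method at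
`λ = b⁻¹ log(1 + bt/v)` gives `P{S ≥ t} ≤ exp(−(v/b²) h(bt/v))`, `h(u) = (1+u) log(1+u) − u`, and
Exercise 2.8 (`h(u) ≥ u²/(2(1 + u/3))`, the tree's `sq_div_le_hFun`) turns it into Bernstein's
`exp(−t²/(2(v + bt/3)))`.

PROVED here for an arbitrary real random variable `Y` on a probability space under the sole
hypothesis `E e^{λY} ≤ exp(v φ(λB)/B²)` for all `λ > 0` (`v, B > 0`; integrability of `e^{λY}` for
`λ > 0` assumed, e.g. `Y` bounded above):
`measureReal_le_le_exp_bennett_of_mgf_le` (Bennett form) and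
`measureReal_le_le_exp_bernstein_of_mgf_le` (Bernstein form).  The computation is the one already
carried out inside `measureReal_le_sum_sub_integral_le_exp_bennett` (`BennettBernsteinMeasure.lean`)
for independent sums; nothing else.  No named facts.

## References
* [BoucheronLugosiMassart2013] S. Boucheron, G. Lugosi, P. Massart, *Concentration Inequalities:
  A Nonasymptotic Theory of Independence*, OUP 2013 — §2.7 Theorem 2.9 (proof) and eq. (2.10),
  Exercise 2.8 (held text pp. 35–36).
-/

noncomputable section

namespace Literature.Probability.Moments

open _root_.MeasureTheory _root_.ProbabilityTheory Finset Real

section CramerChernoff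

variable {Ω : Type*} [MeasurableSpace Ω] {P : Measure Ω} [IsProbabilityMeasure P]

/-- For `Y ≤ C` a.s. and `λ ≥ 0`, `ω ↦ e^{λ Y(ω)}` is integrable (`0 < e^{λY} ≤ e^{λC}`;
private helper). [folklore] -/
private theorem integrable_exp_mul_of_le_const {Y : Ω → ℝ} (hYm : AEMeasurable Y P) {C : ℝ}
    (hYC : ∀ᵐ ω ∂P, Y ω ≤ C) {l : ℝ} (hl : 0 ≤ l) : Integrable (fun ω => exp (l * Y ω)) P := by
  refine Integrable.mono' (integrable_const (exp (l * C))) ?_ ?_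
  · exact (measurable_exp.comp_aemeasurable (hYm.const_mul l)).aestronglyMeasurable
  · filter_upwards [hYC] with ω hω
    rw [Real.norm_eq_abs, abs_of_pos (exp_pos _)]
    exact exp_le_exp.2 (mul_le_mul_of_nonneg_left hω hl)

/-- **Cramér–Chernoff with a Bennett-type MGF bound** (the computation in the proof of BLM
Theorem 2.9, for an arbitrary real random variable): if `E e^{λY} ≤ exp(v φ(λB)/B²)` for all
`λ > 0`, `φ(u) = e^u − u − 1`, `v, B > 0`, then for `t > 0`
`P{Y ≥ t} ≤ exp(−(v/B²) h(Bt/v))`, `h(u) = (1+u) log(1+u) − u` (Chernoff at `λ = log(1+Bt/v)/B`).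
[cite: BoucheronLugosiMassart2013, §2.7 Theorem 2.9 (proof: Cramér–Chernoff from the MGF bound)] -/
theorem measureReal_le_le_exp_bennett_of_mgf_le {Y : Ω → ℝ}
    (hint : ∀ l : ℝ, 0 < l → Integrable (fun ω => exp (l * Y ω)) P) {v B : ℝ} (hv : 0 < v)
    (hB : 0 < B)
    (hmgf : ∀ l : ℝ, 0 < l → mgf Y P l ≤ exp (v * ((exp (l * B) - l * B - 1) / B ^ 2)))
    {t : ℝ} (ht : 0 < t) :
    P.real {ω | t ≤ Y ω}
      ≤ exp (-(v / B ^ 2 * ((1 + B * t / v) * log (1 + B * t / v) - B * t / v))) := by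
  set u : ℝ := B * t / v with hu
  have hu0 : 0 < u := by positivity
  set l : ℝ := log (1 + u) / B with hl
  have hlog : 0 < log (1 + u) := Real.log_pos (by linarith)
  have hl0 : 0 < l := div_pos hlog hB
  have h3 : P.real {ω | t ≤ Y ω} ≤ exp (v * ((exp (l * B) - l * B - 1) / B ^ 2) - l * t) := by
    calc P.real {ω | t ≤ Y ω} ≤ exp (-l * t) * mgf Y P l :=
          measure_ge_le_exp_mul_mgf t hl0.le (hint l hl0)
      _ ≤ exp (-l * t) * exp (v * ((exp (l * B) - l * B - 1) / B ^ 2)) :=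
          mul_le_mul_of_nonneg_left (hmgf l hl0) (exp_pos _).le
      _ = exp (v * ((exp (l * B) - l * B - 1) / B ^ 2) - l * t) := by
          rw [← Real.exp_add]; ring_nf
  have hb' : B ≠ 0 := hB.ne'
  have hv' : v ≠ 0 := hv.ne'
  have hlb : l * B = log (1 + u) := by rw [hl]; field_simp
  have hexp : exp (l * B) = 1 + u := by rw [hlb, Real.exp_log (by linarith)]
  have h4 : v * ((exp (l * B) - l * B - 1) / B ^ 2) - l * t =
      -(v / B ^ 2 * ((1 + u) * log (1 + u) - u)) := by
    rw [hexp, hlb]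
    have ht' : t = u * v / B := by rw [hu]; field_simp
    rw [hl, ht']
    field_simp
    ring
  rw [h4] at h3
  exact h3

/-- **Cramér–Chernoff with a Bennett-type MGF bound, Bernstein form** (BLM (2.10) via Exercise 2.8
`h(u) ≥ u²/(2(1+u/3))`): under the same hypothesis, `P{Y ≥ t} ≤ exp(−t²/(2(v + Bt/3)))`.
[cite: BoucheronLugosiMassart2013, §2.7 eq. (2.10) (Bernstein's inequality)] -/
theorem measureReal_le_le_exp_bernstein_of_mgf_le {Y : Ω → ℝ}
    (hint : ∀ l : ℝ, 0 < l → Integrable (fun ω => exp (l * Y ω)) P) {v B : ℝ} (hv : 0 < v)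
    (hB : 0 < B)
    (hmgf : ∀ l : ℝ, 0 < l → mgf Y P l ≤ exp (v * ((exp (l * B) - l * B - 1) / B ^ 2)))
    {t : ℝ} (ht : 0 < t) :
    P.real {ω | t ≤ Y ω} ≤ exp (-(t ^ 2 / (2 * (v + B * t / 3)))) := by
  refine (measureReal_le_le_exp_bennett_of_mgf_le hint hv hB hmgf ht).trans (exp_le_exp.2 ?_)
  have hh := sq_div_le_hFun (u := B * t / v) (by positivity)
  have hb' : B ≠ 0 := hB.ne'
  have hv' : v ≠ 0 := hv.ne'
  have hkey : t ^ 2 / (2 * (v + B * t / 3)) =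
      v / B ^ 2 * ((B * t / v) ^ 2 / (2 * (1 + B * t / v / 3))) := by
    field_simp
  rw [hkey, neg_le_neg_iff]
  exact mul_le_mul_of_nonneg_left hh (by positivity)

end CramerChernoff

end Literature.Probability.Moments

end
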